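import Literature.ModelTheory.ExponentialFields.PilaWilkieCountingProofs
import Literature.ModelTheory.ExponentialFields.OMinimalCells
import Literature.ModelTheory.ExponentialFields.RealExpFieldProofs
import Literature.ModelTheory.ExponentialFields.CylindricalDecompositionProofs
import Mathlib.Analysis.Analytic.Polynomial
import Mathlib.Analysis.Analytic.Uniqueness
import HarnessLib

/-!
# Semialgebraic cells for the counting theorem (Bhardwaj–van den Dries 2022, §2: Lemmas 2.2 and 2.3)

Topic `Literature/ModelTheory/ExponentialFields`; proof file in the cone of the named fact
`PilaWilkie2006_thm_1_8`.  Bhardwaj–van den Dries 2022, §2 deduce the counting theorem from its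
two ingredients by induction on the dimension, slicing with the hypersurfaces of Bombieri–Pila
and projecting their **semialgebraic cells** to lower dimension.  This file supplies that
machinery for an arbitrary first-order expansion `L` of the real field (graphs of `+`, `·`
definable):

* `IsSemialgebraic.definable_of_field` — `ℝ`-semialgebraic sets are `L`-definable;
* `IsCell.exists_coordProj` — van den Dries Ch. 3 (2.7) concretely: for every cell type `ι` of
  `ℝ^m` a coordinate selection `σ : Fin k → Fin m` (`k < m` unless `ι = (1,…,1)`) such that on
  every `ι`-cell `v ↦ v ∘ σ` has a definable left inverse, continuous on the image;
* `algPart_image_coordProj`, `ncard_ratPointsLE_transPart_le_coordProj` — **Lemma 2.2**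
  (*"`f(X^{alg}) = Y^{alg}` and thus `f(X^{tr}) = Y^{tr}`"*) for such charts on a semialgebraic
  set, and the resulting comparison of counts of rational points of bounded height;
* `IsCylindricalDecomposition.exists_isCell` — the cells of the tree's semialgebraic
  cylindrical decomposition (Basu–Pollack–Roy Def. 5.1) are `L`-cells;
* `interior_zeroSet_eq_empty`, `exists_hypersurfaceFamily`, `exists_hypersurface_cells` —
  **Lemma 2.3**: the universal family of hypersurfaces of degree `≤ e` and finitely many
  semialgebraic `L`-cells of `ℝ^{D+n}` whose fibres cover each of its members.

Nothing here is a named fact; no definitions.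

## References

* N. Bhardwaj, L. van den Dries, *On the Pila–Wilkie theorem*, Expo. Math. 40 (2022), §2,
  Lemmas 2.1–2.3. [BhardwajVanDenDries2022]
* L. van den Dries, *Tame topology and o-minimal structures*, CUP 1998, Ch. 3 (2.7).
  [Dries1998]
* S. Basu, R. Pollack, M.-F. Roy, *Algorithms in Real Algebraic Geometry*, Springer 2006,
  Def. 5.1, Cor. 5.7. [BasuPollackRoy2006]
-/

noncomputable section

open Set FirstOrder FirstOrder.Language Filter Topology

namespace Literature.ModelTheory.ExponentialFields

/-! ### Semialgebraic sets are definable in every expansion of the real field -/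

section SemialgDefinable

variable {L : Language} [L.Structure ℝ]

/-- Polynomial functions with real coefficients are definable (graphs of `+`, `·` definable).
[folklore] -/
theorem definableFun_mvPolynomial_eval {ι : Type} [Finite ι]
    (hadd : (univ : Set ℝ).Definable L {v : Fin 3 → ℝ | v 0 + v 1 = v 2})
    (hmul : (univ : Set ℝ).Definable L {v : Fin 3 → ℝ | v 0 * v 1 = v 2})
    (p : MvPolynomial ι ℝ) :
    (univ : Set ℝ).DefinableFun L (fun x : ι → ℝ => MvPolynomial.eval x p) := by
  induction p using MvPolynomial.induction_on with
  | C a => simpa using definableFun_const' (L := L) ι a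
  | add p q hp hq => simpa using definableFun_add hadd hp hq
  | mul_X p i hp => simpa using definableFun_mul hmul hp (definableFun_proj i)

/-- **Semialgebraic sets are definable in every expansion of the real field**: an
`ℝ`-semialgebraic subset of `ℝ^ι` is definable (with parameters) in any first-order structure
on `ℝ` in which the graphs of `+` and `·` are definable (Boolean combinations of `{p = 0}`,
`{p > 0}`). [folklore] -/
theorem IsSemialgebraic.definable_of_field {ι : Type} [Finite ι]
    (hadd : (univ : Set ℝ).Definable L {v : Fin 3 → ℝ | v 0 + v 1 = v 2})
    (hmul : (univ : Set ℝ).Definable L {v : Fin 3 → ℝ | v 0 * v 1 = v 2})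
    {s : Set (ι → ℝ)} (hs : IsSemialgebraic ℝ s) : (univ : Set ℝ).Definable L s := by
  have hlt := definable_lt_of_field hadd hmul
  induction hs using BooleanSubalgebra.closure_bot_sup_induction with
  | mem t ht =>
    rcases ht with ⟨p, rfl⟩ | ⟨p, rfl⟩
    · have h := definable_setOf_eq' (definableFun_mvPolynomial_eval hadd hmul p) (definableFun_const' _ (0 : ℝ))
      convert h using 2
      simp
    · have h := definable_setOf_lt hlt (definableFun_const' _ (0 : ℝ)) (definableFun_mvPolynomial_eval hadd hmul p)
      convert h using 2
      simp
  | bot => exact definable_empty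
  | sup t _ u _ ht hu => exact ht.union hu
  | compl t _ ht => exact ht.compl

end SemialgDefinable

/-! ### Cells are graphs over their interval coordinates (van den Dries 1998, Ch. 3, (2.7)) -/

section CellProj

variable {L : Language} [L.Structure ℝ]

/-- **(2.7): the projection `p_ι` onto the interval coordinates maps an `ι`-cell
homeomorphically onto its image** (van den Dries 1998, Ch. 3, (2.7)), in the concrete form used
by the counting theorem: for an `ι`-cell `C ⊆ ℝ^m` there are `k ≤ m` (`k < m` unless
`ι = (1, …, 1)`), a coordinate selection `σ : Fin k → Fin m`, and a definable map `q` continuous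
on the image of `e(v) = v ∘ σ` with `q(e(v)) = v` on `C` (so `e` is injective on `C` and a
homeomorphism `C → e(C)` with inverse `q`). [cite: Dries1998, Ch. 3 (2.7)] -/
theorem IsCell.exists_coordProj :
    ∀ (m : ℕ) (ι : Fin m → Bool),
      ∃ k : ℕ, k ≤ m ∧ (ι ≠ (fun _ => true) → k < m) ∧
        ∃ (σ : Fin k → Fin m), ∀ C : Set (Fin m → ℝ), IsCell L m ι C →
          ∃ (q : (Fin k → ℝ) → (Fin m → ℝ)),
            (∀ v ∈ C, q (v ∘ σ) = v) ∧
            ContinuousOn q ((fun v : Fin m → ℝ => v ∘ σ) '' C) ∧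
            (∀ j, (univ : Set ℝ).DefinableFun L (fun y => q y j))
  | 0, ι => by
    refine ⟨0, le_rfl, fun hι => (hι (funext fun i => i.elim0)).elim, Fin.elim0, fun C _ => ?_⟩
    exact ⟨fun _ => (Fin.elim0 : Fin 0 → ℝ), fun v _ => funext fun i => i.elim0, continuousOn_const,
      fun j => j.elim0⟩
  | m + 1, ι => by
    obtain ⟨k, hkm, hk, σ, hσ⟩ := IsCell.exists_coordProj m (Fin.init ι)
    cases hlast : ι (Fin.last m)
    · -- graph type: keep the base coordinates, recover the last one by the cell function
      refine ⟨k, hkm.trans (Nat.le_succ m), fun _ => Nat.lt_succ_of_le hkm,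
        fun j => Fin.castSucc (σ j), fun C hC => ?_⟩
      obtain ⟨X, hX, h⟩ := hC
      rcases h with ⟨-, f, hf, hfc, rfl⟩ | ⟨hlast', -, -, -, -, -, -⟩
      swap
      · rw [hlast] at hlast'; exact absurd hlast' (by simp)
      obtain ⟨q, hq, hqc, hqd⟩ := hσ X hX
      have hqmap : (univ : Set ℝ).DefinableMap L q := hqd
      refine ⟨fun y => Fin.snoc (q y) (f (q y)), ?_, ?_, ?_⟩
      · rintro v ⟨hv, hvf⟩
        have hcomp : (v ∘ fun j => Fin.castSucc (σ j)) = Fin.init v ∘ σ := rfl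
        show Fin.snoc (q (v ∘ fun j => Fin.castSucc (σ j))) (f (q (v ∘ fun j => Fin.castSucc (σ j)))) = v
        rw [hcomp, hq _ hv, ← hvf, Fin.snoc_init_self]
      · have hsub : (fun v : Fin (m + 1) → ℝ => v ∘ fun j => Fin.castSucc (σ j)) ''
            {v | Fin.init v ∈ X ∧ v (Fin.last m) = f (Fin.init v)} ⊆ (fun x : Fin m → ℝ => x ∘ σ) '' X := by
          rintro _ ⟨v, ⟨hv, -⟩, rfl⟩
          exact ⟨Fin.init v, hv, rfl⟩
        have hqc' : ContinuousOn q _ := hqc.mono hsub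
        have hqX : MapsTo q ((fun v : Fin (m + 1) → ℝ => v ∘ fun j => Fin.castSucc (σ j)) ''
            {v | Fin.init v ∈ X ∧ v (Fin.last m) = f (Fin.init v)}) X := by
          rintro _ ⟨v, ⟨hv, -⟩, rfl⟩
          show q (Fin.init v ∘ σ) ∈ X
          rw [hq _ hv]; exact hv
        exact hqc'.finSnoc (hfc.comp hqc' hqX)
      · intro j
        refine Fin.lastCases ?_ (fun j' => ?_) j
        · simp only [Fin.snoc_last]
          exact hf.comp hqmap
        · simp only [Fin.snoc_castSucc]
          exact hqd j'
    · -- band type: keep the base coordinates and the last one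
      have hk' : ι ≠ (fun _ => true) → k < m := by
        intro hι
        refine hk fun hinit => hι ?_
        rw [← Fin.snoc_init_self ι, hinit, hlast]
        funext i
        refine Fin.lastCases ?_ (fun j => ?_) i
        · simp
        · simp
      refine ⟨k + 1, Nat.succ_le_succ hkm, fun hι => Nat.succ_lt_succ (hk' hι),
        Fin.snoc (fun j => Fin.castSucc (σ j)) (Fin.last m), fun C hC => ?_⟩
      obtain ⟨X, hX, h⟩ := hC
      rcases h with ⟨hlast', -, -, -, -⟩ | ⟨-, f, g, -, -, -, rfl⟩
      · rw [hlast] at hlast'; exact absurd hlast' (by simp)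
      obtain ⟨q, hq, hqc, hqd⟩ := hσ X hX
      refine ⟨fun y => Fin.snoc (q (Fin.init y)) (y (Fin.last k)), ?_, ?_, ?_⟩
      · rintro v ⟨hv, -⟩
        have hinit : Fin.init (v ∘ Fin.snoc (fun j => Fin.castSucc (σ j)) (Fin.last m)) = Fin.init v ∘ σ := by
          funext j; simp [Fin.init]
        have hlastv : (v ∘ Fin.snoc (fun j => Fin.castSucc (σ j)) (Fin.last m)) (Fin.last k) = v (Fin.last m) := by
          simp
        show Fin.snoc (q (Fin.init (v ∘ Fin.snoc (fun j => Fin.castSucc (σ j)) (Fin.last m))))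
          ((v ∘ Fin.snoc (fun j => Fin.castSucc (σ j)) (Fin.last m)) (Fin.last k)) = v
        rw [hinit, hlastv, hq _ hv, Fin.snoc_init_self]
      · have hsub : Fin.init '' ((fun v : Fin (m + 1) → ℝ => v ∘ Fin.snoc (fun j => Fin.castSucc (σ j)) (Fin.last m)) ''
            {v | Fin.init v ∈ X ∧ (∀ f' ∈ f, f' (Fin.init v) < v (Fin.last m)) ∧
              ∀ g' ∈ g, v (Fin.last m) < g' (Fin.init v)}) ⊆ (fun x : Fin m → ℝ => x ∘ σ) '' X := by
          rintro _ ⟨_, ⟨v, ⟨hv, -⟩, rfl⟩, rfl⟩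
          refine ⟨Fin.init v, hv, ?_⟩
          funext j; simp [Fin.init]
        have hqc' : ContinuousOn (fun y : Fin (k + 1) → ℝ => q (Fin.init y)) _ :=
          (hqc.mono hsub).comp continuous_init.continuousOn (mapsTo_image _ _)
        exact hqc'.finSnoc (continuous_apply _).continuousOn
      · intro j
        refine Fin.lastCases ?_ (fun j' => ?_) j
        · simp only [Fin.snoc_last]
          exact definableFun_proj _
        · simp only [Fin.snoc_castSucc]
          exact (hqd j').comp fun i => definableFun_proj (Fin.castSucc i)

/-- The coordinate-projection chart of a cell is injective on it — DEPRECATED duplicate of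
Mathlib's `Set.LeftInvOn.injOn` (librarian dedup 2026-08-16, work item dedup-01235): the hypothesis
`hq` is literally `Set.LeftInvOn q (· ∘ σ) C`, so the statement is `hq.injOn`; kept under its old
name as a one-line alias proof (never deleted), no longer used in this file.
[cite: Dries1998, Ch. 3 (2.7)] -/
@[deprecated Set.LeftInvOn.injOn (since := "2026-08-16")]
theorem injOn_of_leftInvOn {m k : ℕ} {C : Set (Fin m → ℝ)} {σ : Fin k → Fin m}
    {q : (Fin k → ℝ) → (Fin m → ℝ)} (hq : ∀ v ∈ C, q (v ∘ σ) = v) :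
    Set.InjOn (fun v : Fin m → ℝ => v ∘ σ) C :=
  Set.LeftInvOn.injOn hq

end CellProj

/-! ### Bhardwaj–van den Dries 2022, Lemma 2.2: injective semialgebraic charts preserve the algebraic part -/

section AlgPartChart

/-- **Bhardwaj–van den Dries 2022, Lemma 2.2** (for coordinate-projection charts): *"Suppose
`S ⊆ ℝ^n` is semialgebraic, `f : S → ℝ^m` is semialgebraic and injective, and `f` maps the set
`X ⊆ S` homeomorphically onto `Y = f(X) ⊆ ℝ^m`. Then `f(X^{alg}) = Y^{alg}` and thus
`f(X^{tr}) = Y^{tr}`."* Here `f(v) = v ∘ σ` is a coordinate projection with a left inverse `q`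
on `S`, continuous on `f(S)` (the situation of a cell and its interval coordinates).
[cite: BhardwajVanDenDries2022, Lemma 2.2] -/
theorem algPart_image_coordProj {m k : ℕ} (σ : Fin k → Fin m) {S X : Set (Fin m → ℝ)}
    (hS : IsSemialgebraic ℝ S) (hXS : X ⊆ S) {q : (Fin k → ℝ) → (Fin m → ℝ)}
    (hq : ∀ v ∈ S, q (v ∘ σ) = v) (hqc : ContinuousOn q ((fun v : Fin m → ℝ => v ∘ σ) '' S)) :
    (fun v : Fin m → ℝ => v ∘ σ) '' algPart X = algPart ((fun v : Fin m → ℝ => v ∘ σ) '' X) := by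
  set e : (Fin m → ℝ) → (Fin k → ℝ) := fun v => v ∘ σ with he
  have hec : Continuous e := continuous_pi fun j => continuous_apply (σ j)
  have hinj : InjOn e S := Set.LeftInvOn.injOn hq
  apply Subset.antisymm
  · rintro _ ⟨a, ha, rfl⟩
    rw [mem_algPart_iff] at ha ⊢
    obtain ⟨A, haA, hAX, hAsa, hAconn, hAinf⟩ := ha
    refine ⟨e '' A, mem_image_of_mem e haA, Set.image_mono hAX, hAsa.image_comp_of_finite σ,
      hAconn.image e hec.continuousOn, hAinf.image (hinj.mono (hAX.trans hXS))⟩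
  · intro b hb
    rw [mem_algPart_iff] at hb
    obtain ⟨B, hbB, hBY, hBsa, hBconn, hBinf⟩ := hb
    -- the semialgebraic set `A = S ∩ e⁻¹(B)` lies in `X` and equals `q(B)`
    set A : Set (Fin m → ℝ) := S ∩ e ⁻¹' B with hA
    have hAX : A ⊆ X := by
      rintro v ⟨hvS, hvB⟩
      obtain ⟨x, hx, hxv⟩ := hBY hvB
      have : x = v := hinj (hXS hx) hvS hxv
      rw [← this]; exact hx
    have hAsa : IsSemialgebraic ℝ A := hS.inter (hBsa.preimage_comp σ)
    have hBS : B ⊆ e '' S := hBY.trans (Set.image_mono hXS)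
    have hAq : A = q '' B := by
      apply Subset.antisymm
      · rintro v ⟨hvS, hvB⟩
        exact ⟨e v, hvB, hq v hvS⟩
      · rintro _ ⟨b', hb', rfl⟩
        obtain ⟨x, hxS, rfl⟩ := hBS hb'
        refine ⟨?_, ?_⟩
        · rw [hq x hxS]; exact hxS
        · show e (q (e x)) ∈ B
          rw [hq x hxS]; exact hb'
    have hAconn : IsConnected A := by
      rw [hAq]; exact hBconn.image q (hqc.mono hBS)
    have heA : e '' A = B := by
      apply Subset.antisymm
      · rintro _ ⟨v, ⟨-, hvB⟩, rfl⟩; exact hvB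
      · intro b' hb'
        obtain ⟨x, hxS, rfl⟩ := hBS hb'
        exact ⟨x, ⟨hxS, hb'⟩, rfl⟩
    have hAinf : A.Infinite := fun hfin => hBinf (heA ▸ hfin.image e)
    obtain ⟨x, hxS, rfl⟩ := hBS hbB
    refine ⟨x, ?_, rfl⟩
    rw [mem_algPart_iff]
    exact ⟨A, ⟨hxS, hbB⟩, hAX, hAsa, hAconn, hAinf⟩

/-- **Counting through a chart** (Bhardwaj–van den Dries 2022, §2: *"for `a ∈ C_l(ℚ)` we have
`p(a) ∈ ℚ^{n_l}` and `H(p(a)) ≤ H(a)` … by Lemma 2.2 applied to the maps `p = p_{C_l}`"*): under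
the hypotheses of `algPart_image_coordProj`, the rational points of height `≤ H` on `X^{tr}`
inject into those on `(e(X))^{tr}`; so if the latter are finite, so are the former, and not more
numerous. [cite: BhardwajVanDenDries2022, §2 (proof of Thm. 2.4)] -/
theorem ncard_ratPointsLE_transPart_le_coordProj {m k : ℕ} (σ : Fin k → Fin m) {S X : Set (Fin m → ℝ)}
    (hS : IsSemialgebraic ℝ S) (hXS : X ⊆ S) {q : (Fin k → ℝ) → (Fin m → ℝ)}
    (hq : ∀ v ∈ S, q (v ∘ σ) = v) (hqc : ContinuousOn q ((fun v : Fin m → ℝ => v ∘ σ) '' S))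
    (H : ℕ) (hfin : (ratPointsLE (transPart ((fun v : Fin m → ℝ => v ∘ σ) '' X)) H).Finite) :
    (ratPointsLE (transPart X) H).Finite ∧
      (ratPointsLE (transPart X) H).ncard ≤
        (ratPointsLE (transPart ((fun v : Fin m → ℝ => v ∘ σ) '' X)) H).ncard := by
  set e : (Fin m → ℝ) → (Fin k → ℝ) := fun v => v ∘ σ with he
  have hinj : InjOn e S := Set.LeftInvOn.injOn hq
  have halg := algPart_image_coordProj σ hS hXS hq hqc
  have hmaps : MapsTo e (ratPointsLE (transPart X) H) (ratPointsLE (transPart (e '' X)) H) := by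
    rintro x ⟨⟨hxX, hxalg⟩, hxrat⟩
    refine ⟨⟨mem_image_of_mem e hxX, fun halg' => ?_⟩, fun j => hxrat (σ j)⟩
    rw [← halg] at halg'
    obtain ⟨a, ha, hax⟩ := halg'
    have : a = x := hinj (hXS (algPart_subset X ha)) (hXS hxX) hax
    exact hxalg (this ▸ ha)
  have hinj' : InjOn e (ratPointsLE (transPart X) H) :=
    hinj.mono fun x hx => hXS hx.1.1
  refine ⟨Set.Finite.of_finite_image (hfin.subset (hmaps.image_subset)) hinj', ?_⟩
  exact Set.ncard_le_ncard_of_injOn e hmaps hinj' hfin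

end AlgPartChart

/-! ### Semialgebraic cylindrical cells are o-minimal cells in every expansion of the real field -/

section CadCells

open Classical

variable {L : Language} [L.Structure ℝ]

/-- A function whose graph over a semialgebraic `S` is semialgebraic agrees on `S` with a globally
definable function (extend by `0`). [folklore] -/
theorem exists_definableFun_eqOn_of_graphOver {n : ℕ}
    (hadd : (univ : Set ℝ).Definable L {v : Fin 3 → ℝ | v 0 + v 1 = v 2})
    (hmul : (univ : Set ℝ).Definable L {v : Fin 3 → ℝ | v 0 * v 1 = v 2})
    {S : Set (Fin n → ℝ)} (hS : IsSemialgebraic ℝ S) {f : (Fin n → ℝ) → ℝ}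
    (hf : IsSemialgebraic ℝ (graphOver S f)) :
    (univ : Set ℝ).DefinableFun L (fun x => if x ∈ S then f x else 0) := by
  have hSd := hS.definable_of_field (L := L) hadd hmul
  have hGd := hf.definable_of_field (L := L) hadd hmul
  unfold Set.DefinableFun
  -- index map `Fin (n + 1) → Option (Fin n)`: `castSucc i ↦ some i`, `last ↦ none`
  set g : Fin (n + 1) → Option (Fin n) := Fin.lastCases none some with hg
  have hsnoc : ∀ v : Option (Fin n) → ℝ, (v ∘ g) = Fin.snoc (v ∘ some) (v none) := by
    intro v; funext i
    refine Fin.lastCases ?_ (fun j => ?_) i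
    · simp [hg]
    · simp [hg]
  have h1 : (univ : Set ℝ).Definable L {v : Option (Fin n) → ℝ | (v ∘ some) ∈ S} := hSd.preimage_comp some
  have h2 : (univ : Set ℝ).Definable L {v : Option (Fin n) → ℝ | (v ∘ g) ∈ graphOver S f} := hGd.preimage_comp g
  have h3 : (univ : Set ℝ).Definable L {v : Option (Fin n) → ℝ | v none = 0} :=
    definable_setOf_eq' (definableFun_proj _) (definableFun_const' _ _)
  have h := h2.union (h1.compl.inter h3)
  convert h using 1
  ext v
  simp only [Function.tupleGraph, mem_setOf_eq, mem_union, mem_inter_iff, mem_compl_iff, hsnoc,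
    snoc_mem_graphOver_iff]
  by_cases hv : (v ∘ some) ∈ S
  · simp only [hv, if_true, not_true, false_and, or_false, true_and]
    exact eq_comm
  · simp only [hv, if_false, false_and, false_or, not_false_eq_true, true_and]
    exact eq_comm

/-- **The cells of a semialgebraic cylindrical decomposition are cells** of every first-order
expansion of the real field (Basu–Pollack–Roy Def. 5.1 versus van den Dries Ch. 3 (2.3): graphs
and bands of continuous semialgebraic — hence definable — sections over lower cells).
[cite: BasuPollackRoy2006, Def. 5.1] [cite: Dries1998, Ch. 3 (2.3)] -/
theorem IsCylindricalDecomposition.exists_isCell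
    (hadd : (univ : Set ℝ).Definable L {v : Fin 3 → ℝ | v 0 + v 1 = v 2})
    (hmul : (univ : Set ℝ).Definable L {v : Fin 3 → ℝ | v 0 * v 1 = v 2}) :
    ∀ {m : ℕ} {𝒮 : Finset (Set (Fin m → ℝ))}, IsCylindricalDecomposition ℝ m 𝒮 →
      ∀ C ∈ 𝒮, ∃ ι, IsCell L m ι C
  | 0, 𝒮, h, C, hC => by
    rw [isCylindricalDecomposition_zero] at h
    subst h
    rw [Finset.mem_singleton] at hC
    exact ⟨fun i => i.elim0, hC⟩
  | m + 1, 𝒯, h, T, hT => by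
    rw [isCylindricalDecomposition_succ] at h
    obtain ⟨-, -, 𝒮, h𝒮, l, ξ, hcont, hsa, hmono, hstack⟩ := h
    obtain ⟨S, hS, hTS⟩ := (hstack T).mp hT
    obtain ⟨ι, hι⟩ := IsCylindricalDecomposition.exists_isCell hadd hmul h𝒮 S hS
    have hSsa : IsSemialgebraic ℝ S := h𝒮.isSemialgebraic S hS
    -- the definable extensions of the sections
    set F : Fin (l S) → (Fin m → ℝ) → ℝ := fun j x => if x ∈ S then ξ S j x else 0 with hF
    have hFdef : ∀ j, (univ : Set ℝ).DefinableFun L (F j) := fun j =>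
      exists_definableFun_eqOn_of_graphOver hadd hmul hSsa
        ((isSemialgebraicFunOn_iff_isSemialgebraic_graphOver).mp (hsa S hS j))
    have hFeq : ∀ j, ∀ x ∈ S, F j x = ξ S j x := fun j x hx => by simp [hF, hx]
    have hFc : ∀ j, ContinuousOn (F j) S := fun j => (hcont S hS j).congr (hFeq j)
    rcases hTS with ⟨j, rfl⟩ | ⟨j, rfl⟩
    · -- graph
      refine ⟨Fin.snoc ι false, ?_⟩
      have heq : graphOver S (ξ S j) = {v : Fin (m + 1) → ℝ | (Fin.init v : Fin m → ℝ) ∈ S ∧ v (Fin.last m) = F j (Fin.init v)} := by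
        ext v
        rw [mem_graphOver_iff]
        constructor
        · rintro ⟨h1, h2⟩; exact ⟨h1, by rw [hFeq j _ h1]; exact h2⟩
        · rintro ⟨h1, h2⟩; exact ⟨h1, by rw [← hFeq j _ h1]; exact h2⟩
      rw [heq]
      exact hι.graph (hFdef j) (hFc j)
    · -- band number `j`
      refine ⟨Fin.snoc ι true, ?_⟩
      set fo : Option ((Fin m → ℝ) → ℝ) := if h0 : j = 0 then none else some (F (j.pred h0)) with hfo
      set go : Option ((Fin m → ℝ) → ℝ) :=
        if hl : j = Fin.last (l S) then none else some (F (j.castPred hl)) with hgo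
      have heq : bandOver S (ξ S) j = {v : Fin (m + 1) → ℝ | (Fin.init v : Fin m → ℝ) ∈ S ∧
          (∀ f' ∈ fo, f' (Fin.init v) < v (Fin.last m)) ∧ ∀ g' ∈ go, v (Fin.last m) < g' (Fin.init v)} := by
        ext v
        rw [mem_bandOver_iff]
        simp only [mem_setOf_eq]
        refine and_congr_right fun hvS => and_congr ?_ ?_
        · by_cases h0 : j = 0
          · subst h0
            simp [hfo]
          · rw [bandLower_of_ne_zero _ _ h0, EReal.coe_lt_coe_iff]
            simp [hfo, h0, hFeq _ _ hvS]
        · by_cases hl : j = Fin.last (l S)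
          · subst hl
            simp [hgo]
          · rw [bandUpper_of_ne_last _ _ hl, EReal.coe_lt_coe_iff]
            simp [hgo, hl, hFeq _ _ hvS]
      rw [heq]
      refine hι.band ?_ ?_ ?_
      · intro f' hf'
        by_cases h0 : j = 0
        · subst h0; simp [hfo] at hf'
        · simp only [hfo, h0, dite_false, Option.mem_def, Option.some.injEq] at hf'
          subst hf'
          exact ⟨hFdef _, hFc _⟩
      · intro g' hg'
        by_cases hl : j = Fin.last (l S)
        · subst hl; simp [hgo] at hg'
        · simp only [hgo, hl, dite_false, Option.mem_def, Option.some.injEq] at hg'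
          subst hg'
          exact ⟨hFdef _, hFc _⟩
      · intro f' hf' g' hg' x hx
        by_cases h0 : j = 0
        · subst h0; simp [hfo] at hf'
        by_cases hl : j = Fin.last (l S)
        · subst hl; simp [hgo] at hg'
        simp only [hfo, h0, dite_false, Option.mem_def, Option.some.injEq] at hf'
        simp only [hgo, hl, dite_false, Option.mem_def, Option.some.injEq] at hg'
        subst hf'; subst hg'
        rw [hFeq _ _ hx, hFeq _ _ hx]
        apply hmono S hS x hx
        -- `pred j < castPred j` in `Fin (l S)`
        rw [Fin.lt_def, Fin.val_pred, Fin.coe_castPred]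
        have : (j : ℕ) ≠ 0 := fun h => h0 (Fin.ext h)
        omega

end CadCells

/-! ### Bhardwaj–van den Dries 2022, Lemma 2.3: the universal family of hypersurfaces of degree `≤ e` and its semialgebraic cells -/

section Hypersurfaces

open Classical MvPolynomial

variable {L : Language} [L.Structure ℝ]

/-- A nonzero real polynomial does not vanish on a non-empty open set: its zero set has empty
interior (identity theorem for the real-analytic polynomial function). [folklore] -/
theorem interior_zeroSet_eq_empty {n : ℕ} {P : MvPolynomial (Fin n) ℝ} (hP : P ≠ 0) :
    interior {x : Fin n → ℝ | eval x P = 0} = ∅ := by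
  by_contra hne
  obtain ⟨z₀, hz₀⟩ := nonempty_iff_ne_empty.mpr hne
  have hev : (fun x : Fin n → ℝ => eval x P) =ᶠ[𝓝 z₀] 0 := by
    filter_upwards [mem_interior_iff_mem_nhds.mp hz₀] with x hx using hx
  have hall := (AnalyticOnNhd.eval_mvPolynomial P).eqOn_zero_of_preconnected_of_eventuallyEq_zero
    isPreconnected_univ (mem_univ z₀) hev
  exact hP (MvPolynomial.funext fun x => by simpa using hall (mem_univ x))

/-- Exponent vectors with entries `≤ e`, as finitely supported functions. [folklore] -/
theorem mem_range_toFinsupp_of_mem_support {n e : ℕ} {P : MvPolynomial (Fin n) ℝ}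
    (hP : P.totalDegree ≤ e) {γ : Fin n →₀ ℕ} (hγ : γ ∈ P.support) :
    ∃ α : Fin n → Fin (e + 1), Finsupp.equivFunOnFinite.symm (fun j => ((α j : ℕ))) = γ := by
  have hdeg := (le_totalDegree hγ).trans hP
  have hj : ∀ j, γ j ≤ e := by
    intro j
    refine le_trans ?_ hdeg
    by_cases hjs : j ∈ γ.support
    · exact Finset.single_le_sum (f := fun i => γ i) (fun i _ => Nat.zero_le _) hjs
    · rw [Finsupp.notMem_support_iff.mp hjs]; exact Nat.zero_le _
  refine ⟨fun j => ⟨γ j, Nat.lt_succ_of_le (hj j)⟩, ?_⟩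
  ext j; simp

/-- **The universal hypersurface family** (Bhardwaj–van den Dries 2022, Lemma 2.3, first part:
*"`{Hy(t) : t ∈ F}` = set of hypersurfaces in `ℝ^n` of degree `≤ e`"*): with
`D = (e+1)^n` coefficients `t` (one for each exponent vector with entries `≤ e`) the set
`Hyp = {(t, x) | Σ_α t_α x^α = 0} ⊆ ℝ^{D+n}` is semialgebraic, and every zero set of a real
polynomial of degree `≤ e` is a fibre `Hyp(t_P)`. [cite: BhardwajVanDenDries2022, Lemma 2.3] -/
theorem exists_hypersurfaceFamily (n e : ℕ) :
    ∃ (D : ℕ) (Hyp : Set (Fin (D + n) → ℝ)) (tP : MvPolynomial (Fin n) ℝ → (Fin D → ℝ)),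
      IsSemialgebraic ℝ Hyp ∧
      ∀ P : MvPolynomial (Fin n) ℝ, P.totalDegree ≤ e →
        ∀ x : Fin n → ℝ, ((Fin.append (tP P) x :) ∈ Hyp ↔ eval x P = 0) := by
  set A := Fin n → Fin (e + 1) with hA
  set D : ℕ := Fintype.card A with hD
  set d : Fin D ≃ A := (Fintype.equivFin A).symm with hd
  set toF : A → (Fin n →₀ ℕ) := fun α => Finsupp.equivFunOnFinite.symm (fun j => ((α j : ℕ))) with htoF
  have htoF_inj : Function.Injective toF := by
    intro α β h
    funext j
    have := congrArg (fun γ : Fin n →₀ ℕ => γ j) h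
    simp only [htoF, Finsupp.coe_equivFunOnFinite_symm] at this
    exact Fin.ext this
  -- the defining polynomial in the variables `Fin (D + n)`
  set Q : MvPolynomial (Fin (D + n)) ℝ :=
    ∑ i : Fin D, X (Fin.castAdd n i) * ∏ j : Fin n, X (Fin.natAdd D j) ^ ((d i j : ℕ)) with hQ
  refine ⟨D, {w | eval w Q = 0}, fun P i => P.coeff (toF (d i)), ?_, fun P hP x => ?_⟩
  · simpa [MvPolynomial.coe_aeval_eq_eval] using
      (isSemialgebraic_setOf_eval_eq_zero (k := ℝ) (R := ℝ) (ι := Fin (D + n)) Q)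
  · -- evaluate `Q` at `(t_P, x)`
    have hQeval : eval (Fin.append (fun i => P.coeff (toF (d i))) x) Q =
        ∑ i : Fin D, P.coeff (toF (d i)) * ∏ j : Fin n, x j ^ ((d i j : ℕ)) := by
      simp [hQ, Fin.append_left, Fin.append_right]
    have hsum : ∑ i : Fin D, P.coeff (toF (d i)) * ∏ j : Fin n, x j ^ ((d i j : ℕ)) =
        ∑ α : A, P.coeff (toF α) * ∏ j : Fin n, x j ^ ((α j : ℕ)) :=
      d.sum_comp (fun α => P.coeff (toF α) * ∏ j : Fin n, x j ^ ((α j : ℕ)))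
    have heval : eval x P = ∑ α : A, P.coeff (toF α) * ∏ j : Fin n, x j ^ ((α j : ℕ)) := by
      rw [eval_eq']
      -- reindex the support by exponent vectors
      have h1 : ∑ γ ∈ P.support, P.coeff γ * ∏ j, x j ^ γ j =
          ∑ γ ∈ (Finset.univ : Finset A).image toF, P.coeff γ * ∏ j, x j ^ γ j := by
        apply Finset.sum_subset
        · intro γ hγ
          obtain ⟨α, hα⟩ := mem_range_toFinsupp_of_mem_support hP hγ
          exact Finset.mem_image.mpr ⟨α, Finset.mem_univ _, hα⟩
        · intro γ _ hγ
          rw [MvPolynomial.notMem_support_iff.mp hγ, zero_mul]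
      rw [h1, Finset.sum_image fun α _ β _ h => htoF_inj h]
      refine Finset.sum_congr rfl fun α _ => ?_
      simp [htoF]
    show eval (Fin.append (fun i => P.coeff (toF (d i))) x) Q = 0 ↔ eval x P = 0
    rw [hQeval, hsum, heval]

/-- **Bhardwaj–van den Dries 2022, Lemma 2.3** (cells of the universal hypersurface family):
*"there are `L ∈ ℕ^{≥1}` and semialgebraic sets `Hy, C_1, …, C_L ⊆ F × ℝ^n` such that
`{Hy(t)} =` set of hypersurfaces of degree `≤ e`, `Hy(t) = C_1(t) ∪ ⋯ ∪ C_L(t)` for all `t`,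
and … every `C_l(t)` is a semialgebraic `ı`-cell in `ℝ^n` or empty"*. Here: finitely many
semialgebraic sets `C ⊆ ℝ^{D+n}`, each a cell of every first-order expansion `L` of the real
field (from the semialgebraic cylindrical decomposition of the tree), whose fibres over `t_P`
cover exactly the zero set of any real polynomial `P` of degree `≤ e`.
[cite: BhardwajVanDenDries2022, Lemma 2.3] -/
theorem exists_hypersurface_cells
    (hadd : (univ : Set ℝ).Definable L {v : Fin 3 → ℝ | v 0 + v 1 = v 2})
    (hmul : (univ : Set ℝ).Definable L {v : Fin 3 → ℝ | v 0 * v 1 = v 2}) (n e : ℕ) :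
    ∃ (D : ℕ) (tP : MvPolynomial (Fin n) ℝ → (Fin D → ℝ)) (𝒞 : Finset (Set (Fin (D + n) → ℝ))),
      (∀ C ∈ 𝒞, IsSemialgebraic ℝ C ∧ ∃ ι, IsCell L (D + n) ι C) ∧
      ∀ P : MvPolynomial (Fin n) ℝ, P.totalDegree ≤ e →
        ∀ x : Fin n → ℝ, (eval x P = 0 ↔ ∃ C ∈ 𝒞, (Fin.append (tP P) x :) ∈ C) := by
  obtain ⟨D, Hyp, tP, hHyp, hfib⟩ := exists_hypersurfaceFamily n e
  obtain ⟨𝒮, hcad, hadapt⟩ :=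
    IsSemialgebraic.exists_cylindricalDecomposition_holds (k := ℝ) {Hyp} (by simpa using hHyp)
  obtain ⟨𝒞, h𝒞𝒮, h𝒞⟩ := hadapt Hyp (Finset.mem_singleton_self _)
  refine ⟨D, tP, 𝒞, fun C hC => ⟨hcad.isSemialgebraic C (h𝒞𝒮 hC),
    IsCylindricalDecomposition.exists_isCell hadd hmul hcad C (h𝒞𝒮 hC)⟩, fun P hP x => ?_⟩
  rw [← hfib P hP x, ← h𝒞]
  simp only [mem_sUnion, Finset.mem_coe]

end Hypersurfaces


end Literature.ModelTheory.ExponentialFields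

end
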